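import Literature.MathematicalPhysics.QuantumFieldTheory.Balaban1983to89.Node00.N24KnitStage12N09
import Literature.MathematicalPhysics.QuantumFieldTheory.Balaban1983to89.Node00.Record12CarriersRecords

/-!
# NODE N24 · THE CLOSER'S INTERFACE OVER THE FOUR-PIN STAGE-12 VIEW `θ.view₁₂B10YZW M⋆ ops ζ λW` (node00-def's `Record12Carriers` ∕ `Record12CarriersRecords`): the bodies of crux
# K1′'s registered stubs and K1′'s rev-15 consequent (item stmt-QuantumFields-19903 `StabilityBAtRecordR12e`) from the children at the presentation's own objects WITH THE [B10] RUN
# FAMILY PINNED TO THE PRINTED TOWER (N08 ← the PRINTED sentence `PrintedUV3V N θ.L`, no leaf-system slot) and the three hidden layers Y ∕ Z ∕ W as CHOSEN OBJECTS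
# (`Y9OfRecord N θ₃ M⋆ ops`, `Z11OfRecord F N ζ`, `WOfRecord₁₂ F N θ λW`) — N09 and N11 by name, N13 world-level

TRACK A (YM-PLAN §2d, node N24 of 28 = binder B2 `hB : B16.EndStatementBPrinted D.C`), seat `pub-ymgap-dag-n24-c` (R134 fan-out seat, strategy s2; gen 2).  TWENTY-NINTH N24 module, a NEW
importing one (modules 1–28 untouched; imports module 28b `N24KnitStage12N09` and node00-def's `Record12CarriersRecords`).  THEOREMS ONLY, def-free, sorry-free, standard axioms.

WHY.  Module 27 ∕ 28b's pointed interface binds the world over the BARE Stage-12 view `θ.toStage5₁₂`, where N08 enters through the leaf-system form of the residual [B10] run family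
of `θ.res.X P` — a slot a closer may satisfy at an EMPTY run family (junk-closable; located and said since module 17).  Node00-def's four-pin view `θ.view₁₂B10YZW F N M⋆ ops ζ λW` PINS the
[B10] group to the printed tower `runsB10OfRecord N θ.L` (so the world's `b10` leaf IS the printed sentence `PrintedUV3V N θ.L`, [Balaban1985UV3] Thm 1 + Thm 2 for every run length at
Bałaban's odd `L > 1` — `upOfRecord₅C_view₁₂B10YZW_leaves`), and the hidden Y ∕ Z ∕ W layers to the NAMED objects of the chosen layers (`Y9OfRecord N θ.toStage3Params M⋆ ops`,
`Z11OfRecord F N ζ`, `WOfRecord₁₂ F N θ λW P` — `rfl`), while the view's [B8] ∕ [B12] ∕ B13 groups and its 𝐑-carrier ARE θ's (`rfl`; the view's 𝐑-leaf is `ROpLeaf (VOfRecord₁₂ F N θ P)`,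
`Iff.rfl`).  A world bound to the four-pin view IS a four-pin record `IsRecordOfRecord₁₂CB10YZW` (node00-def C2) and hence a ₁₂C record over the SAME datum AND world
(`isRecordOfRecord₁₂C_of_isRecordOfRecord₁₂CB10YZW`) — so the skeleton's `IsRecordOfRecord₁₂C … w ∧ ∀ P, Nodes (leavesP w P)` is reached at that world with N08 PRINT-FACING.

WHAT THIS FILE PROVES.
§0 `N24_exists_boundWorld₁₂B10YZW` — a world bound to the four-pin view with prescribed letters; `N24_rOperation_iff_of_up_view₁₂B10YZW` (the view's 𝐑-leaf, `Iff.rfl` + def-T's iff).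
§1 **`N24_nodes₁₂B10YZW_pointed_N09`** — `IsRecordOfRecord₁₂CB10YZW … w ∧ IsRecordOfRecord₁₂C … w ∧ ∀ P, Nodes (leavesP w P)` from: N05 `B8LeafR` at `θ.res.X P`'s [B8] fields; N06
   `B9LeafX (Y9OfRecord N θ.toStage3Params M⋆ ops)`; N07 `B11Leaf (Z11OfRecord F N ζ)`; **N08 `PrintedUV3V N θ.L`**; N09 Lemma-4 leaf at `θ.res.X` + [B11] Thm 1 ×3 at θ's level domains
   (`B12NodeKnitRecord12`, by name); N10 the B13 socket with NAMED antecedents (runs `runsB10OfRecord N θ.L`); N11 (S1ᵀ) (dag-n11-e, by name); N12 `∀ P, B15Leaf (WOfRecord₁₂ F N θ λW P)`; N13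
   𝐑-leaf pointed + Cor.-3 ×5 at the world's own `(e₋, e₊)`; N01–N04 theorems.
§2 `N24_nodesAtSomeRecord₁₂_of_fourPin_pointed_N09`, **`N24_betaWindowAtSomeRecord₁₂_of_fourPin_pointed_N09_of_boxH`** (the two stubs' bodies, guard displayed),
   **`N24_stabilityBR12e_thetaShape15_fourPin_pointed_N09`** (K1′'s rev-15 consequent) — from §1 + the β-box pair on `(datumOfRecord₁₂ θ hP).βfun` along `]0, w.γ]^{k+1}`.

WHICH CHILD BLOCKS (closer's form over the four-pin view): N05 [B8] residual leaf at `θ.res.X` · N06 def-Y's leaf at CHOSEN `(M⋆, ops)` · N07 [B11] leaf at CHOSEN `ζ` · N08 the PRINTED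
`PrintedUV3V N θ.L` · N09 Lemma-4 leaf + [B11] Thm 1 ×3 · N10 B13 socket · N11 (S1ᵀ) · N12 [IV] leaf at CHOSEN `λW` · N13 𝐑-leaf + Cor.-3 ×5 · guard + `Provisos₁₂ ∧ Admissible` = K0′
`Record12Inhabited` (19902) · β⁺ ([I] (1.22) p. 264) + `b > 0` (NODE O, UNPRINTED).  HONEST FRAMING: kernel bookkeeping BY NAME; nothing of Bałaban's asserted; every slot DISPLAYED;
N24 COMPOSITE — no discharge, no count, no stub closed; one finite T⁴ programme at fixed ε; NOT continuum ∕ ℝ⁴ ∕ OS ∕ mass gap ∕ Clay.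
-/

noncomputable section

open scoped Matrix.Norms.L2Operator

namespace Literature.MathematicalPhysics.QuantumFieldTheory.Balaban1983to89.Node00

open DagBinding T4Continuum T4DatumAssembly FlowStepRuns AveragingRT
open FlowStep (BetaLowerH BetaUpperH)

variable {F : T4Family} {N : ℕ} [NeZero N]

/-! ## §0. A world bound to the four-pin view; its 𝐑-leaf -/

/-- **A WORLD BOUND TO THE FOUR-PIN VIEW OF `(θ, hP)` AT CHOSEN LAYERS WITH ANY PRESCRIBED LETTERS** — construction `(datumOfRecord₁₂ θ hP).C`, block size `θ.L`, upstream blocks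
the C-binding of record over `θ.view₁₂B10YZW F N M⋆ ops ζ λW`, letters `(γ, e₋, e₊, β⁺, β₀, b, g_R)` as given.  With `0 < γ ≤ θ.γ` it is a four-pin record (node00-def C2) and a ₁₂C record.
[cite: Balaban1989LargeFieldII, Thm 1 + (0.1) pp.355–356; Balaban1985UV3, (1)–(5) p.256; Balaban1988Convergent, Cor. 3 (2.50) p.264 (objects and letters; bookkeeping)] -/
theorem N24_exists_boundWorld₁₂B10YZW (θ : Stage12Params F N) (hP : θ.Provisos₁₂ F N) (Mstar : ℕ) (ops : OpsY N θ.toStage3Params Mstar) (ζ : ResidZ F N)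
    (lamW : ResidW F N) (γw : ℝ) (em ep : ℝ → ℝ) (βup : ℝ) {β₀ b : ℝ} (hβ₀ : 0 < β₀) (hb : 0 < b) (gR : ℝ) :
    ∃ w : WorldP, w.C = (datumOfRecord₁₂ F N θ hP).C ∧ w.γ = γw ∧ w.L = (θ.L : ℝ) ∧
      (∀ P, w.up P = upOfRecord₅C F N (θ.view₁₂B10YZW F N Mstar ops ζ lamW) P) ∧
      w.em = em ∧ w.ep = ep ∧ w.βup = βup ∧ w.β₀ = β₀ ∧ w.b = b ∧ w.gR = gR :=
  ⟨⟨(datumOfRecord₁₂ F N θ hP).C, γw, em, ep, βup, β₀, hβ₀, b, hb, (θ.L : ℝ), by exact_mod_cast θ.hL.2, gR,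
      fun P => upOfRecord₅C F N (θ.view₁₂B10YZW F N Mstar ops ζ lamW) P⟩,
    rfl, rfl, rfl, fun _ => rfl, rfl, rfl, rfl, rfl, rfl, rfl⟩

/-- **THE 𝐑-LEAF OF A WORLD BOUND TO THE FOUR-PIN VIEW IS θ's REPAIRED R-LAW** «𝐓-image form ⇒ §2 form one level up», `∀ k < K, TLaw₁₂ θ P k → SLaw₁₂ θ P (k+1)`: the pins never touch the
𝐑-carrier (`Iff.rfl` to `ROpLeaf (VOfRecord₁₂ F N θ P)`, then def-T's `rOpLeaf_VOfRecord₁₂_iff`). [cite: Balaban1988Convergent, p.244 and Thm 2 p.263; Balaban1989LargeFieldII, Thm 1 p.355 (bookkeeping)] -/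
theorem N24_rOperation_iff_of_up_view₁₂B10YZW (θ : Stage12Params F N) (Mstar : ℕ) (ops : OpsY N θ.toStage3Params Mstar) (ζ : ResidZ F N) (lamW : ResidW F N)
    {w : WorldP} {P : B12.RunParams} (hup : w.up P = upOfRecord₅C F N (θ.view₁₂B10YZW F N Mstar ops ζ lamW) P) :
    (leavesP w P).rOperation ↔ ∀ k, k < P.K → TLaw₁₂ F N θ P k → SLaw₁₂ F N θ P (k + 1) := by
  have hV : (leavesP w P).rOperation ↔ ROpLeaf (VOfRecord₁₂ F N θ P) := by
    show (w.up P).rOperation ↔ _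
    rw [hup]
    exact Iff.rfl
  exact hV.trans (rOpLeaf_VOfRecord₁₂_iff F N θ P)

/-! ## §1. The thirteen nodes at a world bound to the four-pin view, from the pointed children (N08 print-facing, N09 ∕ N11 by name) -/

/-- **N24 · THE THIRTEEN DAG NODES AT A WORLD BOUND TO THE FOUR-PIN VIEW, FROM THE CHILDREN AT THE PRESENTATION'S OWN OBJECTS AND THE CHOSEN LAYERS.**  A world `w` bound to
`θ.view₁₂B10YZW F N M⋆ ops ζ λW` (`hC`, `hγ`, `hL`, `hup`) IS a four-pin record and a ₁₂C record over `datumOfRecord₁₂ θ hP`, and: **N05** `B8LeafR` at `θ.res.X P`'s [B8] fields (= the view's,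
`rfl`); **N06** def-Y's leaf `B9LeafX (Y9OfRecord N θ.toStage3Params M⋆ ops)`; **N07** `B11Leaf (Z11OfRecord F N ζ)`; **N08** THE PRINTED SENTENCE `PrintedUV3V N θ.L` ([Balaban1985UV3] Thm 1
(compact reading, chair R434) + Thm 2 for every run length — the world's `b10` leaf by `upOfRecord₅C_view₁₂B10YZW_leaves`); **N09** own leaf `Lemma4Printed (θ.res.X P).F12 (θ.res.X P).c12`
+ [Balaban1985Variational] Thm 1 ×3 at θ's level domains (`B12NodeKnitRecord12.thm3Member_stage12_of_hRestrict`, by name); **N10** [Balaban1988RG2Cluster] Lemmas 1–3 at `θ.res.X P`'s B13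
group GIVEN the named in-edge leaves (runs `runsB10OfRecord N θ.L`; `B13NodeKnitRecord5C.b13_main_at_stage5ParamsC` at the view); **N11** (S1ᵀ) at `SLaw₁₂ ∕ TLaw₁₂ θ` (dag-n11-e's
`b14_main_at_record₁₂_of_rOpLeaf`, by name; 𝐑 from the node's own antecedent through §0's leaf identity); **N12** `B15Leaf (WOfRecord₁₂ F N θ λW P)`; **N13** the 𝐑-leaf POINTED
`∀ P k < K, TLaw₁₂ θ P k → SLaw₁₂ θ P (k+1)` + the five [Balaban1988Convergent] Cor.-3 leaves at `((datumOfRecord₁₂ θ hP).C, w.γ)` with the world's own `(w.em, w.ep)` (dag-n13-a's pinned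
theorem at the Stage-5 shadow); N01 ∕ N02 ∕ N04 def-T's transferred theorems, N03 module 23's.  THE HYPOTHESIS LIST IS «WHICH CHILD BLOCKS `stub_nodes12` OVER THE FOUR-PIN VIEW».
[cite: Balaban1989LargeFieldII, Thm 1 p.355, (0.1) pp.355–356, p.387, p.391; Balaban1988Convergent, Thm 1 p.262, Theorem p.245, p.244, Cor. 3 (2.50) p.264 and pp.283–284; Balaban1987RG1, Thm 1 p.259, Thm 3 p.264, Lemma 4 (3.53) p.280, (1.1)–(1.3) p.260; Balaban1985Variational, Thm 1 (8)–(10) p.279; Balaban1985RegularSpaces, Thms 2, 4, 8 pp.83–101; Balaban1985BackgroundPropagators, Thms 3.1–3.15 pp.397–432; Balaban1985UV3, (1)–(5) p.256, Thm 1 p.257 + Thm 2 p.272; Balaban1988RG2Cluster, Lemmas 1–3 pp.9, 11, 20; Balaban1989LargeFieldI, Prop. 1 p.194, (0.2) p.176 (node bookkeeping over the four-pin view)] -/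
theorem N24_nodes₁₂B10YZW_pointed_N09 (θ : Stage12Params F N) (hP : θ.Provisos₁₂ F N) (hθ : θ.Admissible F N)
    (Mstar : ℕ) (ops : OpsY N θ.toStage3Params Mstar) (ζ : ResidZ F N) (lamW : ResidW F N) (w : WorldP)
    (hC : w.C = (datumOfRecord₁₂ F N θ hP).C) (hγ : 0 < w.γ ∧ w.γ ≤ θ.γ) (hL : w.L = (θ.L : ℝ))
    (hup : ∀ P, w.up P = upOfRecord₅C F N (θ.view₁₂B10YZW F N Mstar ops ζ lamW) P)
    (h05 : ∀ P : B12.RunParams,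
      B8LeafR (θ.res.X P).d8 (θ.res.X P).L8 (θ.res.X P).C₂ (θ.res.X P).B₁' (θ.res.X P).B₀' (θ.res.X P).B₁ (θ.res.X P).B₂ (θ.res.X P).c₁
        (θ.res.X P).inp8 (θ.res.X P).B₀β (θ.res.X P).loc8 (θ.res.X P).fam8R (θ.res.X P).lan8 (θ.res.X P).cub8 (θ.res.X P).toAxial8)
    (h06 : B9LeafX (Y9OfRecord N θ.toStage3Params Mstar ops))
    (h07 : B11Leaf (Z11OfRecord F N ζ))
    (h08 : PrintedUV3V N θ.L)
    (h09 : ∀ P : B12.RunParams, B12Sec2to5.Lemma4Printed (θ.res.X P).F12 (θ.res.X P).c12)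
    (h11dom : ∀ (P : B12.RunParams) (k : ℕ), k ≤ P.K →
      ∀ V ∈ domAltOfRecord F N θ.ν P.K k, UkExists F N P.K k θ.εbg V ∧ UniqueUkOrbit F N P.K k θ.εbg V)
    (hres : ∀ (P : B12.RunParams) (k : ℕ), k ≤ P.K → HRestrict F N θ.εbg P.K k (domAltOfRecord F N θ.ν P.K k))
    (huniq : ∀ (P : B12.RunParams) (k : ℕ), k ≤ P.K → ∀ V ∈ domAltOfRecord F N θ.ν P.K k, ∀ j < k,
      UniqueUkOrbit F N P.K (j + 1) θ.εbg (Averaging.iter (avOfRecord F N P.K) (j + 1) (Uk F N P.K k θ.εbg V)))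
    (h10 : ∀ P : B12.RunParams, B9LeafX (Y9OfRecord N θ.toStage3Params Mstar ops) →
      (B10.Thm1PrintedCompact ((θ.view₁₂B10YZW F N Mstar ops ζ lamW).res.X P).runs10 ∧
          B10.Thm2Printed ((θ.view₁₂B10YZW F N Mstar ops ζ lamW).res.X P).runs10) →
        B11Leaf (Z11OfRecord F N ζ) → B12Sec2to5.Lemma4Printed (θ.res.X P).F12 (θ.res.X P).c12 →
          B13.Lemma1Printed (θ.res.X P).S13 (θ.res.X P).c13 ∧ B13.Lemma2Printed (θ.res.X P).S13 (θ.res.X P).c13 ∧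
            B13.Lemma3Printed (θ.res.X P).S13 (θ.res.X P).c13)
    (h11 : ∀ P : B12.RunParams, (leavesP w P).b7 → (leavesP w P).b8 → (leavesP w P).b9 → (leavesP w P).b10 → (leavesP w P).b11 →
      (leavesP w P).smallCouplings → (leavesP w P).smallFieldInductive → (leavesP w P).flowControl →
        ∀ k, k < P.K → SLaw₁₂ F N θ P k → TLaw₁₂ F N θ P k)
    (h12 : ∀ P : B12.RunParams, B15Leaf (WOfRecord₁₂ F N θ lamW P))
    (hR : ∀ (P : B12.RunParams) (k : ℕ), k < P.K → TLaw₁₂ F N θ P k → SLaw₁₂ F N θ P (k + 1))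
    (hcor3 : ∃ R : B14Cor3.ReprFamily (datumOfRecord₁₂ F N θ hP).C,
      B14Cor3.LeafH (datumOfRecord₁₂ F N θ hP).C R w.γ ∧ B14Cor3.LeafU1 (datumOfRecord₁₂ F N θ hP).C R w.γ ∧
        B14Cor3.LeafU2 (datumOfRecord₁₂ F N θ hP).C R w.γ w.ep ∧ B14Cor3.LeafL1 (datumOfRecord₁₂ F N θ hP).C R w.γ ∧
          B14Cor3.LeafL2 (datumOfRecord₁₂ F N θ hP).C R w.γ w.em) :
    IsRecordOfRecord₁₂CB10YZW F N (datumOfRecord₁₂ F N θ hP) w ∧ IsRecordOfRecord₁₂C F N (datumOfRecord₁₂ F N θ hP) w ∧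
      ∀ P : B12.RunParams, Nodes (leavesP w P) := by
  have hrec₄ : IsRecordOfRecord₁₂CB10YZW F N (datumOfRecord₁₂ F N θ hP) w := ⟨θ, hP, Mstar, ops, ζ, lamW, hθ, rfl, hC, hγ, hL, hup⟩
  have hrec : IsRecordOfRecord₁₂C F N (datumOfRecord₁₂ F N θ hP) w := isRecordOfRecord₁₂C_of_isRecordOfRecord₁₂CB10YZW hrec₄
  obtain ⟨D₅, h₅, hC5, -⟩ := exists_isRecordOfRecord₅C_of_isRecordOfRecord₁₂C hrec
  rw [← hC5] at hcor3
  obtain ⟨R, hH, hU1, hU2, hL1, hL2⟩ := hcor3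
  have hRw : ∀ P : B12.RunParams, (w.up P).rOperation := fun P =>
    (N24_rOperation_iff_of_up_view₁₂B10YZW θ Mstar ops ζ lamW (hup P)).2 (hR P)
  have h16 := B16NodeKnitRecordPinned.b16_main_of_isRecordOfRecord₅C_of_leaf h₅ hRw R hH hU1 hU2 hL1 hL2
  refine ⟨hrec₄, hrec, fun P => ?_⟩
  have hl := upOfRecord₅C_view₁₂B10YZW_leaves F N θ Mstar ops ζ lamW P
  have h8 : (w.up P).b8 := by
    rw [hup P]; exact (B11LeafUnpinnedRecord.upOfRecord₅C_b8_b9_b11 (θ.view₁₂B10YZW F N Mstar ops ζ lamW) P).1.2 (h05 P)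
  have h9 : (w.up P).b9 := by rw [hup P]; exact hl.2.1.2 h06
  have h10leaf : (w.up P).b10 := by rw [hup P]; exact hl.2.2.1.2 h08
  have h11leaf : (w.up P).b11 := by rw [hup P]; exact hl.2.2.2.2 h07
  have h15 : (w.up P).rBasicStep := by rw [hup P]; exact hl.1.2 (h12 P)
  have h12leaf : (leavesP w P).b12 := by
    show (w.up P).b12
    rw [hup P]; exact h09 P
  exact ⟨b4_main_of_isRecordOfRecord₁₂C hrec P, b5_main_of_isRecordOfRecord₁₂C hrec P, N24_b6_main_of_isRecordOfRecord₁₂C hrec P,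
    b7_main_of_isRecordOfRecord₁₂C hrec P, B8LeafKnit.b8_main_of_leaf w P h8, fun _ _ _ _ => h9, fun _ _ _ _ _ _ => h10leaf,
    fun _ _ _ _ _ => h11leaf, B12NodeKnitRecord8.b12_main_of_leaf_of_thm3Member h12leaf
      (B12NodeKnitRecord12.thm3Member_stage12_of_hRestrict θ hP hC P (h11dom P) (hres P) (huniq P)),
    B13NodeKnitRecord5C.b13_main_at_stage5ParamsC F N (θ.view₁₂B10YZW F N Mstar ops ζ lamW) w P (hup P) (h10 P),
    B14NodeKnitRecord12R.b14_main_at_record₁₂_of_rOpLeaf F N θ hP w P hC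
      (fun hrop => (rOpLeaf_VOfRecord₁₂_iff F N θ P).2 ((N24_rOperation_iff_of_up_view₁₂B10YZW θ Mstar ops ζ lamW (hup P)).1 hrop)) (h11 P),
    B15LeafKnit.b15_main_of_up (U := w.up P) rfl h15, h16 P⟩

/-! ## §2. The two stubs' bodies and K1′'s rev-15 consequent over the four-pin view -/

/-- **THE BODY OF `NodesAtSomeRecord12` OVER THE FOUR-PIN VIEW** (general `N`; at `N := 2` plan g64's text; guard `hU` DISPLAYED — K0′'s product): witnesses `(θ, hP, w)` themselves.
[cite: Balaban1989LargeFieldII, Thm 1 p.355 + p.391; Balaban1988Convergent, (3.16)–(3.22) pp.268–269; Balaban1985UV3, Thm 1 p.257 (bookkeeping)] -/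
theorem N24_nodesAtSomeRecord₁₂_of_fourPin_pointed_N09 (θ : Stage12Params F N) (hP : θ.Provisos₁₂ F N) (hθ : θ.Admissible F N)
    (hU : θ.ZtUnity F N ∧ θ.SlotsNondegenerate)
    (Mstar : ℕ) (ops : OpsY N θ.toStage3Params Mstar) (ζ : ResidZ F N) (lamW : ResidW F N) (w : WorldP)
    (hC : w.C = (datumOfRecord₁₂ F N θ hP).C) (hγ : 0 < w.γ ∧ w.γ ≤ θ.γ) (hL : w.L = (θ.L : ℝ))
    (hup : ∀ P, w.up P = upOfRecord₅C F N (θ.view₁₂B10YZW F N Mstar ops ζ lamW) P)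
    (h05 : ∀ P : B12.RunParams,
      B8LeafR (θ.res.X P).d8 (θ.res.X P).L8 (θ.res.X P).C₂ (θ.res.X P).B₁' (θ.res.X P).B₀' (θ.res.X P).B₁ (θ.res.X P).B₂ (θ.res.X P).c₁
        (θ.res.X P).inp8 (θ.res.X P).B₀β (θ.res.X P).loc8 (θ.res.X P).fam8R (θ.res.X P).lan8 (θ.res.X P).cub8 (θ.res.X P).toAxial8)
    (h06 : B9LeafX (Y9OfRecord N θ.toStage3Params Mstar ops))
    (h07 : B11Leaf (Z11OfRecord F N ζ))
    (h08 : PrintedUV3V N θ.L)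
    (h09 : ∀ P : B12.RunParams, B12Sec2to5.Lemma4Printed (θ.res.X P).F12 (θ.res.X P).c12)
    (h11dom : ∀ (P : B12.RunParams) (k : ℕ), k ≤ P.K →
      ∀ V ∈ domAltOfRecord F N θ.ν P.K k, UkExists F N P.K k θ.εbg V ∧ UniqueUkOrbit F N P.K k θ.εbg V)
    (hres : ∀ (P : B12.RunParams) (k : ℕ), k ≤ P.K → HRestrict F N θ.εbg P.K k (domAltOfRecord F N θ.ν P.K k))
    (huniq : ∀ (P : B12.RunParams) (k : ℕ), k ≤ P.K → ∀ V ∈ domAltOfRecord F N θ.ν P.K k, ∀ j < k,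
      UniqueUkOrbit F N P.K (j + 1) θ.εbg (Averaging.iter (avOfRecord F N P.K) (j + 1) (Uk F N P.K k θ.εbg V)))
    (h10 : ∀ P : B12.RunParams, B9LeafX (Y9OfRecord N θ.toStage3Params Mstar ops) →
      (B10.Thm1PrintedCompact ((θ.view₁₂B10YZW F N Mstar ops ζ lamW).res.X P).runs10 ∧
          B10.Thm2Printed ((θ.view₁₂B10YZW F N Mstar ops ζ lamW).res.X P).runs10) →
        B11Leaf (Z11OfRecord F N ζ) → B12Sec2to5.Lemma4Printed (θ.res.X P).F12 (θ.res.X P).c12 →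
          B13.Lemma1Printed (θ.res.X P).S13 (θ.res.X P).c13 ∧ B13.Lemma2Printed (θ.res.X P).S13 (θ.res.X P).c13 ∧
            B13.Lemma3Printed (θ.res.X P).S13 (θ.res.X P).c13)
    (h11 : ∀ P : B12.RunParams, (leavesP w P).b7 → (leavesP w P).b8 → (leavesP w P).b9 → (leavesP w P).b10 → (leavesP w P).b11 →
      (leavesP w P).smallCouplings → (leavesP w P).smallFieldInductive → (leavesP w P).flowControl →
        ∀ k, k < P.K → SLaw₁₂ F N θ P k → TLaw₁₂ F N θ P k)
    (h12 : ∀ P : B12.RunParams, B15Leaf (WOfRecord₁₂ F N θ lamW P))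
    (hR : ∀ (P : B12.RunParams) (k : ℕ), k < P.K → TLaw₁₂ F N θ P k → SLaw₁₂ F N θ P (k + 1))
    (hcor3 : ∃ R : B14Cor3.ReprFamily (datumOfRecord₁₂ F N θ hP).C,
      B14Cor3.LeafH (datumOfRecord₁₂ F N θ hP).C R w.γ ∧ B14Cor3.LeafU1 (datumOfRecord₁₂ F N θ hP).C R w.γ ∧
        B14Cor3.LeafU2 (datumOfRecord₁₂ F N θ hP).C R w.γ w.ep ∧ B14Cor3.LeafL1 (datumOfRecord₁₂ F N θ hP).C R w.γ ∧
          B14Cor3.LeafL2 (datumOfRecord₁₂ F N θ hP).C R w.γ w.em) :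
    ∃ (θ' : Stage12Params F N) (h' : θ'.Provisos₁₂ F N) (w' : WorldP), (θ'.ZtUnity F N ∧ θ'.SlotsNondegenerate) ∧ θ'.Admissible F N ∧
      IsRecordOfRecord₁₂C F N (datumOfRecord₁₂ F N θ' h') w' ∧ ∀ P : B12.RunParams, Nodes (leavesP w' P) := by
  obtain ⟨-, hrec, hn⟩ := N24_nodes₁₂B10YZW_pointed_N09 θ hP hθ Mstar ops ζ lamW w hC hγ hL hup h05 h06 h07 h08 h09 h11dom hres huniq
    h10 h11 h12 hR hcor3
  exact ⟨θ, hP, w, hU, hθ, hrec, hn⟩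

/-- **THE BODY OF `BetaWindowAtSomeRecord12` OVER THE FOUR-PIN VIEW WITH THE β-BOX PAIR** `w.b ≤ (datumOfRecord₁₂ θ hP).βfun ≤ w.βup` on `]0, w.γ]^{k+1}` (upper: [Balaban1987RG1] (1.22)
p. 264, proof deferred in print; lower with `w.b > 0`: UNPRINTED, T09.F = NODE O): witnesses `(θ, hP, w)` themselves; interval and window by module 26 §2.
[cite: Balaban1987RG1, §1 (1.22) p.264, Thm 2 p.259, Thm 3 p.264, (0.17)–(0.20) pp.255–256; Balaban1985UV3, Thm 1 p.257; Balaban1989LargeFieldII, Thm 1 p.355 (bookkeeping)] -/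
theorem N24_betaWindowAtSomeRecord₁₂_of_fourPin_pointed_N09_of_boxH (θ : Stage12Params F N) (hP : θ.Provisos₁₂ F N) (hθ : θ.Admissible F N)
    (hU : θ.ZtUnity F N ∧ θ.SlotsNondegenerate)
    (Mstar : ℕ) (ops : OpsY N θ.toStage3Params Mstar) (ζ : ResidZ F N) (lamW : ResidW F N) (w : WorldP)
    (hC : w.C = (datumOfRecord₁₂ F N θ hP).C) (hγ : 0 < w.γ ∧ w.γ ≤ θ.γ) (hL : w.L = (θ.L : ℝ))
    (hup : ∀ P, w.up P = upOfRecord₅C F N (θ.view₁₂B10YZW F N Mstar ops ζ lamW) P)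
    (h05 : ∀ P : B12.RunParams,
      B8LeafR (θ.res.X P).d8 (θ.res.X P).L8 (θ.res.X P).C₂ (θ.res.X P).B₁' (θ.res.X P).B₀' (θ.res.X P).B₁ (θ.res.X P).B₂ (θ.res.X P).c₁
        (θ.res.X P).inp8 (θ.res.X P).B₀β (θ.res.X P).loc8 (θ.res.X P).fam8R (θ.res.X P).lan8 (θ.res.X P).cub8 (θ.res.X P).toAxial8)
    (h06 : B9LeafX (Y9OfRecord N θ.toStage3Params Mstar ops))
    (h07 : B11Leaf (Z11OfRecord F N ζ))
    (h08 : PrintedUV3V N θ.L)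
    (h09 : ∀ P : B12.RunParams, B12Sec2to5.Lemma4Printed (θ.res.X P).F12 (θ.res.X P).c12)
    (h11dom : ∀ (P : B12.RunParams) (k : ℕ), k ≤ P.K →
      ∀ V ∈ domAltOfRecord F N θ.ν P.K k, UkExists F N P.K k θ.εbg V ∧ UniqueUkOrbit F N P.K k θ.εbg V)
    (hres : ∀ (P : B12.RunParams) (k : ℕ), k ≤ P.K → HRestrict F N θ.εbg P.K k (domAltOfRecord F N θ.ν P.K k))
    (huniq : ∀ (P : B12.RunParams) (k : ℕ), k ≤ P.K → ∀ V ∈ domAltOfRecord F N θ.ν P.K k, ∀ j < k,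
      UniqueUkOrbit F N P.K (j + 1) θ.εbg (Averaging.iter (avOfRecord F N P.K) (j + 1) (Uk F N P.K k θ.εbg V)))
    (h10 : ∀ P : B12.RunParams, B9LeafX (Y9OfRecord N θ.toStage3Params Mstar ops) →
      (B10.Thm1PrintedCompact ((θ.view₁₂B10YZW F N Mstar ops ζ lamW).res.X P).runs10 ∧
          B10.Thm2Printed ((θ.view₁₂B10YZW F N Mstar ops ζ lamW).res.X P).runs10) →
        B11Leaf (Z11OfRecord F N ζ) → B12Sec2to5.Lemma4Printed (θ.res.X P).F12 (θ.res.X P).c12 →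
          B13.Lemma1Printed (θ.res.X P).S13 (θ.res.X P).c13 ∧ B13.Lemma2Printed (θ.res.X P).S13 (θ.res.X P).c13 ∧
            B13.Lemma3Printed (θ.res.X P).S13 (θ.res.X P).c13)
    (h11 : ∀ P : B12.RunParams, (leavesP w P).b7 → (leavesP w P).b8 → (leavesP w P).b9 → (leavesP w P).b10 → (leavesP w P).b11 →
      (leavesP w P).smallCouplings → (leavesP w P).smallFieldInductive → (leavesP w P).flowControl →
        ∀ k, k < P.K → SLaw₁₂ F N θ P k → TLaw₁₂ F N θ P k)
    (h12 : ∀ P : B12.RunParams, B15Leaf (WOfRecord₁₂ F N θ lamW P))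
    (hR : ∀ (P : B12.RunParams) (k : ℕ), k < P.K → TLaw₁₂ F N θ P k → SLaw₁₂ F N θ P (k + 1))
    (hcor3 : ∃ R : B14Cor3.ReprFamily (datumOfRecord₁₂ F N θ hP).C,
      B14Cor3.LeafH (datumOfRecord₁₂ F N θ hP).C R w.γ ∧ B14Cor3.LeafU1 (datumOfRecord₁₂ F N θ hP).C R w.γ ∧
        B14Cor3.LeafU2 (datumOfRecord₁₂ F N θ hP).C R w.γ w.ep ∧ B14Cor3.LeafL1 (datumOfRecord₁₂ F N θ hP).C R w.γ ∧
          B14Cor3.LeafL2 (datumOfRecord₁₂ F N θ hP).C R w.γ w.em)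
    (hlo : BetaLowerH w.b w.γ (datumOfRecord₁₂ F N θ hP).βfun) (hhi : BetaUpperH w.βup w.γ (datumOfRecord₁₂ F N θ hP).βfun) :
    ∃ (θ' : Stage12Params F N) (h' : θ'.Provisos₁₂ F N) (w' : WorldP), (θ'.ZtUnity F N ∧ θ'.SlotsNondegenerate) ∧ θ'.Admissible F N ∧
      IsRecordOfRecord₁₂C F N (datumOfRecord₁₂ F N θ' h') w' ∧ (∀ P : B12.RunParams, Nodes (leavesP w' P)) ∧
      BetaBoundsInInterval w'.C.toB12 w'.γ w'.b w'.βup ∧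
      ∃ γ₁ : ℝ, 0 < γ₁ ∧ ∀ γ : ℝ, 0 < γ → γ ≤ γ₁ → ∃ P : B12.RunParams, 1 ≤ P.K ∧ ((datumOfRecord₁₂ F N θ' h').C P).flow.InInterval γ P.K := by
  obtain ⟨-, hrec, hn⟩ := N24_nodes₁₂B10YZW_pointed_N09 θ hP hθ Mstar ops ζ lamW w hC hγ hL hup h05 h06 h07 h08 h09 h11dom hres huniq
    h10 h11 h12 hR hcor3
  exact ⟨θ, hP, w, hU, hθ, hrec, hn, N24_betaBoundsInInterval_of_isRecordOfRecord₁₂C_of_boxH hrec hlo hhi,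
    N24_window_of_betaUpperH _ hγ.1 hhi⟩

/-- **THE CONSEQUENT OF ITEM K1′ `StabilityBAtRecordR12e` (rev 15, stmt-QuantumFields-19903) OVER THE FOUR-PIN VIEW**, witnessed by `(θ, hP)`: (B) at `(datumOfRecord₁₂ θ hP).C` by def-T's END
headline at §1's nodes with the interval β-binder from the box pair, the window from `hhi` (module 26 §2); guard `hU` DISPLAYED.  THE CLOSER'S RECIPE OVER THE FOUR-PIN VIEW: a guarded
admissible presentation (K0′), chosen layers `(M⋆, ops, ζ, λW)` with def-Y's ∕ [B11]'s ∕ [IV]'s leaves, the PRINTED [B10] sentence at `θ.L`, N05's residual [B8] leaf, N09's Lemma-4 leaf +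
[B11] Thm 1 ×3, N10's B13 socket, N11's (S1ᵀ), N13's 𝐑-leaf + Cor.-3 ×5, and the β-box pair (β⁺ [I] p. 264; `b > 0` NODE O, UNPRINTED).  COMPOSITE: nothing is discharged.
[cite: Balaban1989LargeFieldII, Thm 1 p.355 + p.391; Balaban1988Convergent, (3.16)–(3.22) pp.268–269; Balaban1987RG1, Thm 3 p.264, (0.17)–(0.20) pp.255–256 and (1.22) p.264; Balaban1985UV3, Thm 1 p.257 + Thm 2 p.272; Balaban1985Variational, Thm 1 p.279 (bookkeeping + elementary window)] -/
theorem N24_stabilityBR12e_thetaShape15_fourPin_pointed_N09 (θ : Stage12Params F N) (hP : θ.Provisos₁₂ F N) (hθ : θ.Admissible F N)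
    (hU : θ.ZtUnity F N ∧ θ.SlotsNondegenerate)
    (Mstar : ℕ) (ops : OpsY N θ.toStage3Params Mstar) (ζ : ResidZ F N) (lamW : ResidW F N) (w : WorldP)
    (hC : w.C = (datumOfRecord₁₂ F N θ hP).C) (hγ : 0 < w.γ ∧ w.γ ≤ θ.γ) (hL : w.L = (θ.L : ℝ))
    (hup : ∀ P, w.up P = upOfRecord₅C F N (θ.view₁₂B10YZW F N Mstar ops ζ lamW) P)
    (h05 : ∀ P : B12.RunParams,
      B8LeafR (θ.res.X P).d8 (θ.res.X P).L8 (θ.res.X P).C₂ (θ.res.X P).B₁' (θ.res.X P).B₀' (θ.res.X P).B₁ (θ.res.X P).B₂ (θ.res.X P).c₁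
        (θ.res.X P).inp8 (θ.res.X P).B₀β (θ.res.X P).loc8 (θ.res.X P).fam8R (θ.res.X P).lan8 (θ.res.X P).cub8 (θ.res.X P).toAxial8)
    (h06 : B9LeafX (Y9OfRecord N θ.toStage3Params Mstar ops))
    (h07 : B11Leaf (Z11OfRecord F N ζ))
    (h08 : PrintedUV3V N θ.L)
    (h09 : ∀ P : B12.RunParams, B12Sec2to5.Lemma4Printed (θ.res.X P).F12 (θ.res.X P).c12)
    (h11dom : ∀ (P : B12.RunParams) (k : ℕ), k ≤ P.K →
      ∀ V ∈ domAltOfRecord F N θ.ν P.K k, UkExists F N P.K k θ.εbg V ∧ UniqueUkOrbit F N P.K k θ.εbg V)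
    (hres : ∀ (P : B12.RunParams) (k : ℕ), k ≤ P.K → HRestrict F N θ.εbg P.K k (domAltOfRecord F N θ.ν P.K k))
    (huniq : ∀ (P : B12.RunParams) (k : ℕ), k ≤ P.K → ∀ V ∈ domAltOfRecord F N θ.ν P.K k, ∀ j < k,
      UniqueUkOrbit F N P.K (j + 1) θ.εbg (Averaging.iter (avOfRecord F N P.K) (j + 1) (Uk F N P.K k θ.εbg V)))
    (h10 : ∀ P : B12.RunParams, B9LeafX (Y9OfRecord N θ.toStage3Params Mstar ops) →
      (B10.Thm1PrintedCompact ((θ.view₁₂B10YZW F N Mstar ops ζ lamW).res.X P).runs10 ∧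
          B10.Thm2Printed ((θ.view₁₂B10YZW F N Mstar ops ζ lamW).res.X P).runs10) →
        B11Leaf (Z11OfRecord F N ζ) → B12Sec2to5.Lemma4Printed (θ.res.X P).F12 (θ.res.X P).c12 →
          B13.Lemma1Printed (θ.res.X P).S13 (θ.res.X P).c13 ∧ B13.Lemma2Printed (θ.res.X P).S13 (θ.res.X P).c13 ∧
            B13.Lemma3Printed (θ.res.X P).S13 (θ.res.X P).c13)
    (h11 : ∀ P : B12.RunParams, (leavesP w P).b7 → (leavesP w P).b8 → (leavesP w P).b9 → (leavesP w P).b10 → (leavesP w P).b11 →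
      (leavesP w P).smallCouplings → (leavesP w P).smallFieldInductive → (leavesP w P).flowControl →
        ∀ k, k < P.K → SLaw₁₂ F N θ P k → TLaw₁₂ F N θ P k)
    (h12 : ∀ P : B12.RunParams, B15Leaf (WOfRecord₁₂ F N θ lamW P))
    (hR : ∀ (P : B12.RunParams) (k : ℕ), k < P.K → TLaw₁₂ F N θ P k → SLaw₁₂ F N θ P (k + 1))
    (hcor3 : ∃ R : B14Cor3.ReprFamily (datumOfRecord₁₂ F N θ hP).C,
      B14Cor3.LeafH (datumOfRecord₁₂ F N θ hP).C R w.γ ∧ B14Cor3.LeafU1 (datumOfRecord₁₂ F N θ hP).C R w.γ ∧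
        B14Cor3.LeafU2 (datumOfRecord₁₂ F N θ hP).C R w.γ w.ep ∧ B14Cor3.LeafL1 (datumOfRecord₁₂ F N θ hP).C R w.γ ∧
          B14Cor3.LeafL2 (datumOfRecord₁₂ F N θ hP).C R w.γ w.em)
    (hlo : BetaLowerH w.b w.γ (datumOfRecord₁₂ F N θ hP).βfun) (hhi : BetaUpperH w.βup w.γ (datumOfRecord₁₂ F N θ hP).βfun) :
    ∃ (θ' : Stage12Params F N) (h' : θ'.Provisos₁₂ F N), (θ'.ZtUnity F N ∧ θ'.SlotsNondegenerate) ∧ θ'.Admissible F N ∧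
      B16.EndStatementBPrinted (datumOfRecord₁₂ F N θ' h').C ∧
      ∃ γ₁ : ℝ, 0 < γ₁ ∧ ∀ γ : ℝ, 0 < γ → γ ≤ γ₁ → ∃ P : B12.RunParams, 1 ≤ P.K ∧ ((datumOfRecord₁₂ F N θ' h').C P).flow.InInterval γ P.K := by
  obtain ⟨-, hrec, hn⟩ := N24_nodes₁₂B10YZW_pointed_N09 θ hP hθ Mstar ops ζ lamW w hC hγ hL hup h05 h06 h07 h08 h09 h11dom hres huniq
    h10 h11 h12 hR hcor3
  exact ⟨θ, hP, hU, hθ, endStatementBPrinted_of_isRecordOfRecord₁₂C_of_nodes hrec le_rfl hn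
    (N24_betaBoundsInInterval_of_isRecordOfRecord₁₂C_of_boxH hrec hlo hhi), N24_window_of_betaUpperH _ hγ.1 hhi⟩

end Literature.MathematicalPhysics.QuantumFieldTheory.Balaban1983to89.Node00

end
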